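import Literature.Analysis.FluidPDE.PassiveVectorTestOperator
import Literature.Analysis.OperatorTheory.LionsProjection
import HarnessLib

/-!
# Damped `L²` weak solutions of the passive-vector equation by Lions' projection theorem

Analysis/FluidPDE file (everything proved; no definitions, no named facts). **J.-L. Lions' existence theorem**
(`OperatorTheory.LionsProjection.exists_eq_of_coercive`; Lions–Magenes 1972, Chap. 3, Thm. 1.1 and §4.3)
applied to the (damped) passive solenoidal vector equation on `T^d × (0,T)` (`A = 0` class of
`Torus.IsWeakPassiveVectorOn`, Yoshida–Kaneda 2000 (4)–(5)): for `T > 0`, `ν ≥ 0`, a jointly measurable carrier `b`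
with `‖b‖ ≤ M` a.e. on `(0,T) × T^d`, weakly divergence free for a.e. `t`, and a datum `w₀ ∈ L²(T^d)`, there is
`v ∈ L²(μ_T)` (`μ_T = vol|(0,T) ⊗ vol_{T^d}`) IN THE CLOSED SPAN OF THE DIVERGENCE-FREE SPACE–TIME TESTS with

  `∫_{μ_T} ⟪v, ∂ₜψ - ψ + (b·∇)ψ + νΔψ⟫ + ∫⟪w₀, ψ(0)⟫ = 0`  for every divergence-free test `ψ` on `[0,T)`

(`exists_dampedWeak_mem_closure`). Hilbert space `F` = closure of the span of the tests in `L²(μ_T)` (so the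
solution inherits every closed linear constraint satisfied by divergence-free tests — used by the sequel to get
weak incompressibility a.e.), `Φ` = divergence-free tests as a real vector space, `j` = inclusion,
`E(u,ψ) = -⟪u, Lψ⟫_{L²}` with `Lψ = ∂ₜψ - ψ + (b·∇)ψ + νΔψ ∈ L²(μ_T)` (`PassiveVectorTestOperator`),
`q(ψ)² = ‖ψ‖²_{L²(μ_T)} + ½‖ψ(0)‖²`, coercivity `q² ≤ E(jψ,ψ)` from `PassiveVectorTestForms.setIntegral_passiveForm_ge`,
`L(ψ) = ∫⟪w₀,ψ(0)⟫` with `|Lψ| ≤ √2‖w₀‖₂ q(ψ)`. The undamping `u = e^{t}v`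
(`PassiveVectorTestOperator.undamped_weak_of_damped`) and the upgrade of `u` to the class
`IsWeakPassiveVectorOn 0 T ν b w₀` (`L^∞_t L²_x` by the Galerkin energy argument) are the sequels; consumer:
stub `stub_existence` of support item `CascadeBookkeeping` (route `SolenoidalFractalHomogenisation`, cell `ad-ideate`).

## Mathlib / tree search

Tree: `OperatorTheory.LionsProjection` (no PDE consumer before this file), `PassiveVectorTestForms`,
`PassiveVectorTestOperator`, `TorusTestFunction` (`IsSpaceTimeTest.add/smul`, `partialDeriv_add`). Mathlib:
`MeasureTheory.L2.inner_def`, `Submodule.topologicalClosure`, `IsClosed.completeSpace_coe`, `LinearMap.mk₂`.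

## References

* J.-L. Lions, E. Magenes, *Non-homogeneous boundary value problems and applications* I (1972), Chap. 3,
  Thm. 1.1, Remark 1.3, §4.3. [`LionsMagenes1972`]
* R. Temam, *Navier–Stokes Equations*, 3rd ed. (1984), Ch. III §1.1–1.2. [`Temam1984`]
* K. Yoshida, Y. Kaneda, Phys. Rev. E 63 (2000) 016308, §II eq. (4)–(5). [`YoshidaKaneda2000`]
-/

noncomputable section

open MeasureTheory Set Filter Function TopologicalSpace
open scoped ENNReal NNReal InnerProductSpace Topology

namespace Literature.Analysis.FluidPDE

namespace Torus

variable {d : Type*} [Fintype d] [DecidableEq d]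

/-! ## Divergence-free tests form a subspace -/

/-- Smooth divergence-free fields are closed under addition. [folklore] -/
private theorem isDivFree_add₁ {u v : UnitAddTorus d → EuclideanSpace ℝ d}
    (hu : FunctionSpaces.Torus.IsSmooth u) (hv : FunctionSpaces.Torus.IsSmooth v)
    (hud : FunctionSpaces.Torus.IsDivFree u) (hvd : FunctionSpaces.Torus.IsDivFree v) :
    FunctionSpaces.Torus.IsDivFree (u + v) := by
  intro x
  have hu1 : ∀ i, FunctionSpaces.Torus.IsContDiff 1 (fun y => u y i) := fun i =>
    (hu.apply i).isContDiff (by simp)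
  have hv1 : ∀ i, FunctionSpaces.Torus.IsContDiff 1 (fun y => v y i) := fun i =>
    (hv.apply i).isContDiff (by simp)
  have h : ∀ i, FunctionSpaces.Torus.partialDeriv i (fun y => (u + v) y i) x =
      FunctionSpaces.Torus.partialDeriv i (fun y => u y i) x + FunctionSpaces.Torus.partialDeriv i (fun y => v y i) x := by
    intro i
    have e : (fun y => (u + v) y i) = (fun y => u y i) + fun y => v y i := by
      funext y; simp
    rw [e, FunctionSpaces.Torus.partialDeriv_add (hu1 i) (hv1 i)]
    rfl
  unfold FunctionSpaces.Torus.divergence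
  simp_rw [h]
  rw [Finset.sum_add_distrib]
  have h0 := hud x
  have h1 := hvd x
  unfold FunctionSpaces.Torus.divergence at h0 h1
  rw [h0, h1, add_zero]

/-- Smooth divergence-free fields: the zero field is divergence free. [folklore] -/
private theorem isDivFree_zero₁ : FunctionSpaces.Torus.IsDivFree (0 : UnitAddTorus d → EuclideanSpace ℝ d) := by
  intro x
  simp [FunctionSpaces.Torus.divergence, FunctionSpaces.Torus.partialDeriv, FunctionSpaces.Torus.lineDeriv]

omit [Fintype d] in
/-- `∂ᵢ (c f) = c ∂ᵢ f` for real functions on `T^d`. [folklore] -/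
private theorem partialDeriv_const_mul₁ (c : ℝ) (f : UnitAddTorus d → ℝ) (i : d) (x : UnitAddTorus d) :
    FunctionSpaces.Torus.partialDeriv i (fun y => c * f y) x = c * FunctionSpaces.Torus.partialDeriv i f x := by
  simp only [FunctionSpaces.Torus.partialDeriv, FunctionSpaces.Torus.lineDeriv, deriv_const_mul_field']

/-- A constant multiple of a divergence-free field is divergence free. [folklore] -/
private theorem isDivFree_const_smul₁ {G : UnitAddTorus d → EuclideanSpace ℝ d}
    (hG : FunctionSpaces.Torus.IsDivFree G) (c : ℝ) : FunctionSpaces.Torus.IsDivFree (c • G) := by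
  intro x
  have h : ∀ i : d, FunctionSpaces.Torus.partialDeriv i (fun y => (c • G) y i) x =
      c * FunctionSpaces.Torus.partialDeriv i (fun y => G y i) x := by
    intro i
    have e : (fun y => (c • G) y i) = fun y => c * G y i := by
      funext y; simp [Pi.smul_apply, smul_eq_mul]
    rw [e, partialDeriv_const_mul₁]
  unfold FunctionSpaces.Torus.divergence
  simp_rw [h]
  rw [← Finset.mul_sum]
  have h0 := hG x
  unfold FunctionSpaces.Torus.divergence at h0
  rw [h0, mul_zero]

/-! ## Lions' theorem applied: a damped `L²` weak solution in the closed span of the tests -/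

/-- **Damped `L²` weak solutions of the passive-vector equation exist** (J.-L. Lions' projection theorem in the
closed span `F ⊆ L²(μ_T)` of the divergence-free space–time tests): for `T > 0`, `ν ≥ 0`, `‖b‖ ≤ M` a.e. on
`(0,T) × T^d` with `b(t)` weakly divergence free for a.e. `t`, and `w₀ ∈ L²`, there is `v ∈ F` with
`∫_{μ_T}⟪v, ∂ₜψ - ψ + (b·∇)ψ + νΔψ⟫ + ∫⟪w₀, ψ(0)⟫ = 0` for all divergence-free tests `ψ`.
[cite: LionsMagenes1972, Chap. 3 Thm. 1.1] -/
theorem exists_dampedWeak_mem_closure {T ν : ℝ} (hT : 0 < T) (hν : 0 ≤ ν)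
    {b : ℝ → UnitAddTorus d → EuclideanSpace ℝ d}
    (hbm : AEStronglyMeasurable (uncurry b) (((volume : Measure ℝ).restrict (Ioo 0 T)).prod volume)) {M : ℝ}
    (hbM : ∀ᵐ p ∂(((volume : Measure ℝ).restrict (Ioo 0 T)).prod (volume : Measure (UnitAddTorus d))),
      ‖uncurry b p‖ ≤ M)
    (hbdiv : ∀ᵐ t ∂(volume.restrict (Ioo 0 T)), FunctionSpaces.Torus.IsWeaklyDivFree (b t))
    {w₀ : UnitAddTorus d → EuclideanSpace ℝ d} (hw₀ : MemLp w₀ 2 volume) :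
    ∃ v : Lp (EuclideanSpace ℝ d) 2 (((volume : Measure ℝ).restrict (Ioo 0 T)).prod (volume : Measure (UnitAddTorus d))),
      v ∈ (Submodule.span ℝ {f : Lp (EuclideanSpace ℝ d) 2
            (((volume : Measure ℝ).restrict (Ioo 0 T)).prod (volume : Measure (UnitAddTorus d))) |
          ∃ ψ : ℝ → UnitAddTorus d → EuclideanSpace ℝ d, FunctionSpaces.Torus.IsSpaceTimeTest T ψ ∧
            FunctionSpaces.Torus.IsDivFreeTest ψ ∧
            (f : ℝ × UnitAddTorus d → EuclideanSpace ℝ d) =ᵐ[((volume : Measure ℝ).restrict (Ioo 0 T)).prod volume] uncurry ψ}).topologicalClosure ∧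
      ∀ ψ : ℝ → UnitAddTorus d → EuclideanSpace ℝ d, FunctionSpaces.Torus.IsSpaceTimeTest T ψ →
        FunctionSpaces.Torus.IsDivFreeTest ψ →
        (∫ p, ⟪(v : ℝ × UnitAddTorus d → EuclideanSpace ℝ d) p,
            FunctionSpaces.Torus.timeDeriv ψ p.1 p.2 - ψ p.1 p.2 + FunctionSpaces.Torus.convect (b p.1) (ψ p.1) p.2 +
              ν • FunctionSpaces.Torus.laplacian (ψ p.1) p.2⟫_ℝ ∂(((volume : Measure ℝ).restrict (Ioo 0 T)).prod volume)) +
          ∫ x, ⟪w₀ x, ψ 0 x⟫_ℝ = 0 := by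
  set μ : Measure (ℝ × UnitAddTorus d) := ((volume : Measure ℝ).restrict (Ioo 0 T)).prod volume with hμ
  -- ### the test space as a real vector space
  let S : Submodule ℝ (ℝ → UnitAddTorus d → EuclideanSpace ℝ d) :=
    { carrier := {ψ | FunctionSpaces.Torus.IsSpaceTimeTest T ψ ∧ FunctionSpaces.Torus.IsDivFreeTest ψ}
      add_mem' := fun {ψ χ} hψ hχ => ⟨hψ.1.add hχ.1, fun t =>
        isDivFree_add₁ (hψ.1.isSmooth_slice t) (hχ.1.isSmooth_slice t) (hψ.2 t) (hχ.2 t)⟩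
      zero_mem' := ⟨FunctionSpaces.Torus.isSpaceTimeTest_zero T, fun t => isDivFree_zero₁⟩
      smul_mem' := fun c ψ hψ => ⟨hψ.1.smul c, fun t => isDivFree_const_smul₁ (hψ.2 t) c⟩ }
  have hS : ∀ ψ : S, FunctionSpaces.Torus.IsSpaceTimeTest T (ψ : ℝ → UnitAddTorus d → EuclideanSpace ℝ d) ∧
      FunctionSpaces.Torus.IsDivFreeTest (ψ : ℝ → UnitAddTorus d → EuclideanSpace ℝ d) := fun ψ => ψ.2
  -- ### the Hilbert space and the embedding of the tests
  have memj : ∀ ψ : S, MemLp (uncurry (ψ : ℝ → UnitAddTorus d → EuclideanSpace ℝ d)) 2 μ := fun ψ =>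
    (hS ψ).1.memLp_two_uncurry
  let j₀ : S → Lp (EuclideanSpace ℝ d) 2 μ := fun ψ => (memj ψ).toLp _
  let Fsub : Submodule ℝ (Lp (EuclideanSpace ℝ d) 2 μ) := (Submodule.span ℝ (Set.range j₀)).topologicalClosure
  haveI hFclosed : IsClosed (Fsub : Set (Lp (EuclideanSpace ℝ d) 2 μ)) := Submodule.isClosed_topologicalClosure _
  haveI : CompleteSpace Fsub := hFclosed.completeSpace_coe
  have hj₀mem : ∀ ψ, j₀ ψ ∈ Fsub := fun ψ =>
    Submodule.le_topologicalClosure _ (Submodule.subset_span ⟨ψ, rfl⟩)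
  have hj₀add : ∀ ψ χ : S, j₀ (ψ + χ) = j₀ ψ + j₀ χ := by
    intro ψ χ
    rw [← MemLp.toLp_add]
    rfl
  have hj₀smul : ∀ (c : ℝ) (ψ : S), j₀ (c • ψ) = c • j₀ ψ := by
    intro c ψ
    rw [← MemLp.toLp_const_smul]
    rfl
  let j : S →ₗ[ℝ] Fsub :=
    { toFun := fun ψ => ⟨j₀ ψ, hj₀mem ψ⟩
      map_add' := fun ψ χ => Subtype.ext (hj₀add ψ χ)
      map_smul' := fun c ψ => Subtype.ext (hj₀smul c ψ) }
  -- ### the images of the tests under the damped operator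
  set Lop : (ℝ → UnitAddTorus d → EuclideanSpace ℝ d) → ℝ × UnitAddTorus d → EuclideanSpace ℝ d := fun ψ p =>
    FunctionSpaces.Torus.timeDeriv ψ p.1 p.2 - ψ p.1 p.2 + FunctionSpaces.Torus.convect (b p.1) (ψ p.1) p.2 +
      ν • FunctionSpaces.Torus.laplacian (ψ p.1) p.2 with hLop
  have memK : ∀ ψ : S, MemLp (Lop (ψ : ℝ → UnitAddTorus d → EuclideanSpace ℝ d)) 2 μ := fun ψ =>
    memLp_two_dampedOp (hS ψ).1 hbm hbM
  let K₀ : S → Lp (EuclideanSpace ℝ d) 2 μ := fun ψ => (memK ψ).toLp _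
  have hK₀add : ∀ ψ χ : S, K₀ (ψ + χ) = K₀ ψ + K₀ χ := by
    intro ψ χ
    rw [← MemLp.toLp_add]
    refine (MemLp.toLp_eq_toLp_iff _ _).2 (ae_of_all _ fun p => ?_)
    exact dampedOp_add (hS ψ).1 (hS χ).1 p
  have hK₀smul : ∀ (c : ℝ) (ψ : S), K₀ (c • ψ) = c • K₀ ψ := by
    intro c ψ
    rw [← MemLp.toLp_const_smul]
    refine (MemLp.toLp_eq_toLp_iff _ _).2 (ae_of_all _ fun p => ?_)
    exact dampedOp_const_smul (hS ψ).1 c p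
  -- ### the bilinear form `E(u, ψ) = -⟪K₀ ψ, u⟫`
  let E : Fsub →ₗ[ℝ] S →ₗ[ℝ] ℝ := LinearMap.mk₂ ℝ
    (fun u ψ => -⟪K₀ ψ, (u : Lp (EuclideanSpace ℝ d) 2 μ)⟫_ℝ)
    (fun u u' ψ => by simp only [Submodule.coe_add, inner_add_right, neg_add])
    (fun c u ψ => by simp only [Submodule.coe_smul, inner_smul_right, smul_eq_mul, mul_neg])
    (fun u ψ χ => by rw [hK₀add, inner_add_left, neg_add])
    (fun c u ψ => by rw [hK₀smul, real_inner_smul_left, smul_eq_mul, mul_neg])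
  have hE : ∀ ψ : S, ∃ Kc : ℝ, ∀ u : Fsub, |E u ψ| ≤ Kc * ‖u‖ := by
    intro ψ
    refine ⟨‖K₀ ψ‖, fun u => ?_⟩
    show |-⟪K₀ ψ, (u : Lp (EuclideanSpace ℝ d) 2 μ)⟫_ℝ| ≤ ‖K₀ ψ‖ * ‖u‖
    rw [abs_neg]
    exact (abs_real_inner_le_norm _ _).trans (le_of_eq (by rw [Submodule.coe_norm]))
  -- ### the size function and the datum functional
  let q : S → ℝ := fun ψ => Real.sqrt (‖j₀ ψ‖ ^ 2 + (1 / 2) * ∫ x, ‖(ψ : ℝ → UnitAddTorus d → EuclideanSpace ℝ d) 0 x‖ ^ 2)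
  have hq : ∀ ψ, 0 ≤ q ψ := fun ψ => Real.sqrt_nonneg _
  have hj : ∀ ψ, ‖j ψ‖ ≤ 1 * q ψ := by
    intro ψ
    rw [one_mul]
    show ‖(⟨j₀ ψ, hj₀mem ψ⟩ : Fsub)‖ ≤ q ψ
    rw [Submodule.coe_norm]
    refine Real.le_sqrt_of_sq_le ?_
    have h0 : 0 ≤ (1 / 2) * ∫ x, ‖(ψ : ℝ → UnitAddTorus d → EuclideanSpace ℝ d) 0 x‖ ^ 2 :=
      mul_nonneg (by norm_num) (integral_nonneg fun x => sq_nonneg _)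
    linarith
  -- ### coercivity (`PassiveVectorTestForms.setIntegral_passiveForm_ge`)
  have hcoer : ∀ ψ : S, 1 * q ψ ^ 2 ≤ E (j ψ) ψ := by
    intro ψ
    obtain ⟨hψ, hdiv⟩ := hS ψ
    rw [one_mul, Real.sq_sqrt (by
      have h0 : 0 ≤ (1 / 2) * ∫ x, ‖(ψ : ℝ → UnitAddTorus d → EuclideanSpace ℝ d) 0 x‖ ^ 2 :=
        mul_nonneg (by norm_num) (integral_nonneg fun x => sq_nonneg _)
      positivity)]
    show ‖j₀ ψ‖ ^ 2 + (1 / 2) * ∫ x, ‖(ψ : ℝ → UnitAddTorus d → EuclideanSpace ℝ d) 0 x‖ ^ 2 ≤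
      -⟪K₀ ψ, j₀ ψ⟫_ℝ
    -- the `L²(μ)` inner product as a space–time integral
    have hinner : ⟪K₀ ψ, j₀ ψ⟫_ℝ = ∫ p, ⟪(ψ : ℝ → UnitAddTorus d → EuclideanSpace ℝ d) p.1 p.2,
        Lop (ψ : ℝ → UnitAddTorus d → EuclideanSpace ℝ d) p⟫_ℝ ∂μ := by
      rw [MeasureTheory.L2.inner_def]
      refine integral_congr_ae ?_
      filter_upwards [(memK ψ).coeFn_toLp, (memj ψ).coeFn_toLp] with p hp hq'
      rw [show (K₀ ψ : ℝ × UnitAddTorus d → EuclideanSpace ℝ d) p = Lop _ p from hp,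
        show (j₀ ψ : ℝ × UnitAddTorus d → EuclideanSpace ℝ d) p = uncurry _ p from hq', real_inner_comm]
      rfl
    have hnorm : ‖j₀ ψ‖ ^ 2 = ∫ t in Ioo 0 T, ∫ x, ‖(ψ : ℝ → UnitAddTorus d → EuclideanSpace ℝ d) t x‖ ^ 2 := by
      have h1 : ‖j₀ ψ‖ ^ 2 = ∫ p, ‖uncurry (ψ : ℝ → UnitAddTorus d → EuclideanSpace ℝ d) p‖ ^ 2 ∂μ := by
        rw [← real_inner_self_eq_norm_sq, MeasureTheory.L2.inner_def]
        refine integral_congr_ae ?_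
        filter_upwards [(memj ψ).coeFn_toLp] with p hp
        rw [show (j₀ ψ : ℝ × UnitAddTorus d → EuclideanSpace ℝ d) p = uncurry _ p from hp, real_inner_self_eq_norm_sq]
      rw [h1, hμ, integral_prod _ ((memj ψ).integrable_norm_pow two_ne_zero)]
      rfl
    have hprod : ∫ p, ⟪(ψ : ℝ → UnitAddTorus d → EuclideanSpace ℝ d) p.1 p.2,
        Lop (ψ : ℝ → UnitAddTorus d → EuclideanSpace ℝ d) p⟫_ℝ ∂μ =
        ∫ t in Ioo 0 T, ∫ x, ⟪(ψ : ℝ → UnitAddTorus d → EuclideanSpace ℝ d) t x,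
          FunctionSpaces.Torus.timeDeriv (ψ : ℝ → UnitAddTorus d → EuclideanSpace ℝ d) t x -
            (ψ : ℝ → UnitAddTorus d → EuclideanSpace ℝ d) t x +
            FunctionSpaces.Torus.convect (b t) ((ψ : ℝ → UnitAddTorus d → EuclideanSpace ℝ d) t) x +
            ν • FunctionSpaces.Torus.laplacian ((ψ : ℝ → UnitAddTorus d → EuclideanSpace ℝ d) t) x⟫_ℝ := by
      have hint : Integrable (fun p : ℝ × UnitAddTorus d => ⟪(ψ : ℝ → UnitAddTorus d → EuclideanSpace ℝ d) p.1 p.2,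
          Lop (ψ : ℝ → UnitAddTorus d → EuclideanSpace ℝ d) p⟫_ℝ) μ := by
        refine Integrable.mono' ((((memj ψ).integrable_norm_pow two_ne_zero).add
          ((memK ψ).integrable_norm_pow two_ne_zero)).div_const 2) ((memj ψ).1.inner (memK ψ).1)
          (ae_of_all _ fun p => ?_)
        rw [Real.norm_eq_abs]
        have h := abs_real_inner_le_norm ((ψ : ℝ → UnitAddTorus d → EuclideanSpace ℝ d) p.1 p.2)
          (Lop (ψ : ℝ → UnitAddTorus d → EuclideanSpace ℝ d) p)
        have h2 : ‖(ψ : ℝ → UnitAddTorus d → EuclideanSpace ℝ d) p.1 p.2‖ *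
            ‖Lop (ψ : ℝ → UnitAddTorus d → EuclideanSpace ℝ d) p‖ ≤
            (‖uncurry (ψ : ℝ → UnitAddTorus d → EuclideanSpace ℝ d) p‖ ^ 2 +
              ‖Lop (ψ : ℝ → UnitAddTorus d → EuclideanSpace ℝ d) p‖ ^ 2) / 2 := by
          have : ‖uncurry (ψ : ℝ → UnitAddTorus d → EuclideanSpace ℝ d) p‖ =
              ‖(ψ : ℝ → UnitAddTorus d → EuclideanSpace ℝ d) p.1 p.2‖ := rfl
          rw [this]
          nlinarith [sq_nonneg (‖(ψ : ℝ → UnitAddTorus d → EuclideanSpace ℝ d) p.1 p.2‖ -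
            ‖Lop (ψ : ℝ → UnitAddTorus d → EuclideanSpace ℝ d) p‖)]
        exact h.trans h2
      rw [hμ, integral_prod _ hint]
    rw [hinner, hnorm, hprod]
    exact setIntegral_passiveForm_ge hT hν hψ hbdiv hbm hbM
  -- ### the datum functional
  have hintL : ∀ ψ : S, Integrable (fun x => ⟪w₀ x, (ψ : ℝ → UnitAddTorus d → EuclideanSpace ℝ d) 0 x⟫_ℝ) volume :=
    fun ψ => FunctionSpaces.Torus.integrable_inner_of_continuous (hw₀.integrable one_le_two)
      ((hS ψ).1.isSmooth_slice 0).continuous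
  let L : S →ₗ[ℝ] ℝ :=
    { toFun := fun ψ => ∫ x, ⟪w₀ x, (ψ : ℝ → UnitAddTorus d → EuclideanSpace ℝ d) 0 x⟫_ℝ
      map_add' := fun ψ χ => by
        show ∫ x, ⟪w₀ x, ((ψ : ℝ → UnitAddTorus d → EuclideanSpace ℝ d) + χ) 0 x⟫_ℝ = _
        simp only [Pi.add_apply, inner_add_right]
        exact integral_add (hintL ψ) (hintL χ)
      map_smul' := fun c ψ => by
        show ∫ x, ⟪w₀ x, (c • (ψ : ℝ → UnitAddTorus d → EuclideanSpace ℝ d)) 0 x⟫_ℝ = _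
        simp only [Pi.smul_apply, real_inner_smul_right, integral_const_mul, smul_eq_mul, RingHom.id_apply] }
  have hL : ∀ ψ : S, |L ψ| ≤ Real.sqrt 2 * Real.sqrt (∫ x, ‖w₀ x‖ ^ 2) * q ψ := by
    intro ψ
    show |∫ x, ⟪w₀ x, (ψ : ℝ → UnitAddTorus d → EuclideanSpace ℝ d) 0 x⟫_ℝ| ≤ _
    have hψ0 : MemLp ((ψ : ℝ → UnitAddTorus d → EuclideanSpace ℝ d) 0) 2 volume :=
      ((hS ψ).1.isSmooth_slice 0).continuous.memLp_of_hasCompactSupport (HasCompactSupport.of_compactSpace _)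
    have hcs : |∫ x, ⟪w₀ x, (ψ : ℝ → UnitAddTorus d → EuclideanSpace ℝ d) 0 x⟫_ℝ| ≤
        Real.sqrt (∫ x, ‖w₀ x‖ ^ 2) * Real.sqrt (∫ x, ‖(ψ : ℝ → UnitAddTorus d → EuclideanSpace ℝ d) 0 x‖ ^ 2) := by
      calc |∫ x, ⟪w₀ x, (ψ : ℝ → UnitAddTorus d → EuclideanSpace ℝ d) 0 x⟫_ℝ|
          ≤ ∫ x, |⟪w₀ x, (ψ : ℝ → UnitAddTorus d → EuclideanSpace ℝ d) 0 x⟫_ℝ| := abs_integral_le_integral_abs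
        _ ≤ ∫ x, ‖w₀ x‖ * ‖(ψ : ℝ → UnitAddTorus d → EuclideanSpace ℝ d) 0 x‖ :=
            integral_mono_of_nonneg (ae_of_all _ fun x => abs_nonneg _)
              (by
                obtain ⟨C, hC⟩ := (isCompact_univ.image ((hS ψ).1.isSmooth_slice 0).continuous).isBounded.exists_norm_le
                have hC' : ∀ x, ‖(ψ : ℝ → UnitAddTorus d → EuclideanSpace ℝ d) 0 x‖ ≤ C := fun x => hC _ ⟨x, mem_univ _, rfl⟩
                exact ((hw₀.integrable one_le_two).norm.mul_const C).mono'
                  ((hw₀.integrable one_le_two).norm.aestronglyMeasurable.mul hψ0.1.norm)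
                  (ae_of_all _ fun x => by
                    rw [Real.norm_eq_abs, abs_of_nonneg (mul_nonneg (norm_nonneg _) (norm_nonneg _))]
                    exact mul_le_mul_of_nonneg_left (hC' x) (norm_nonneg _)))
              (ae_of_all _ fun x => abs_real_inner_le_norm _ _)
        _ ≤ _ := FunctionSpaces.Torus.integral_norm_mul_norm_le_sqrt_sq_mul_sqrt_sq hw₀ hψ0
    have hq2 : Real.sqrt (∫ x, ‖(ψ : ℝ → UnitAddTorus d → EuclideanSpace ℝ d) 0 x‖ ^ 2) ≤ Real.sqrt 2 * q ψ := by
      rw [← Real.sqrt_mul (by norm_num : (0:ℝ) ≤ 2)]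
      refine Real.sqrt_le_sqrt ?_
      have hn : 0 ≤ ‖j₀ ψ‖ ^ 2 := sq_nonneg _
      show ∫ x, ‖(ψ : ℝ → UnitAddTorus d → EuclideanSpace ℝ d) 0 x‖ ^ 2 ≤
        2 * (‖j₀ ψ‖ ^ 2 + (1 / 2) * ∫ x, ‖(ψ : ℝ → UnitAddTorus d → EuclideanSpace ℝ d) 0 x‖ ^ 2)
      linarith
    calc |∫ x, ⟪w₀ x, (ψ : ℝ → UnitAddTorus d → EuclideanSpace ℝ d) 0 x⟫_ℝ|
        ≤ Real.sqrt (∫ x, ‖w₀ x‖ ^ 2) * (Real.sqrt 2 * q ψ) :=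
          hcs.trans (mul_le_mul_of_nonneg_left hq2 (Real.sqrt_nonneg _))
      _ = Real.sqrt 2 * Real.sqrt (∫ x, ‖w₀ x‖ ^ 2) * q ψ := by ring
  -- ### Lions' theorem
  obtain ⟨u, hu⟩ := Literature.Analysis.OperatorTheory.exists_eq_of_coercive j q hq zero_le_one hj E hE one_pos hcoer L
    (by positivity) hL
  refine ⟨(u : Lp (EuclideanSpace ℝ d) 2 μ), ?_, fun ψ hψ hdiv => ?_⟩
  · -- membership: `Fsub` is contained in the closure of the span of the advertised set
    have hsub : Set.range j₀ ⊆ {f : Lp (EuclideanSpace ℝ d) 2 μ |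
        ∃ ψ : ℝ → UnitAddTorus d → EuclideanSpace ℝ d, FunctionSpaces.Torus.IsSpaceTimeTest T ψ ∧
          FunctionSpaces.Torus.IsDivFreeTest ψ ∧ (f : ℝ × UnitAddTorus d → EuclideanSpace ℝ d) =ᵐ[μ] uncurry ψ} := by
      rintro f ⟨ψ, rfl⟩
      exact ⟨ψ, (hS ψ).1, (hS ψ).2, (memj ψ).coeFn_toLp⟩
    exact Submodule.topologicalClosure_mono (Submodule.span_mono hsub) u.2
  · have h := hu ⟨ψ, hψ, hdiv⟩
    -- `E u ψ = -⟪K₀ ψ, u⟫ = L ψ = ∫⟪w₀, ψ 0⟫`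
    change -⟪K₀ ⟨ψ, hψ, hdiv⟩, (u : Lp (EuclideanSpace ℝ d) 2 μ)⟫_ℝ = ∫ x, ⟪w₀ x, ψ 0 x⟫_ℝ at h
    have hinner : ⟪K₀ ⟨ψ, hψ, hdiv⟩, (u : Lp (EuclideanSpace ℝ d) 2 μ)⟫_ℝ =
        ∫ p, ⟪(u : ℝ × UnitAddTorus d → EuclideanSpace ℝ d) p, Lop ψ p⟫_ℝ ∂μ := by
      rw [MeasureTheory.L2.inner_def]
      refine integral_congr_ae ?_
      filter_upwards [(memK ⟨ψ, hψ, hdiv⟩).coeFn_toLp] with p hp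
      rw [show (K₀ ⟨ψ, hψ, hdiv⟩ : ℝ × UnitAddTorus d → EuclideanSpace ℝ d) p = Lop ψ p from hp, real_inner_comm]
    rw [hinner] at h
    linarith

end Torus

end Literature.Analysis.FluidPDE

end
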